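import Summits.HodgeConjecture.HodgeConjecture.Theorems.Ring2AbelianAllAndreFibreClassRankOneInvariants
import HarnessLib

/-!
# Ring 2 · sub-cell AbelianAll (ALL ABELIAN VARIETIES), André axis, part XV-f — LEFSCHETZ-GENERIC PENCILS: the
# fibre-class Lefschetz node (β′_f) HOLDS OUTRIGHT on every compact pencil of abelian `d`-folds whose invariant
# classes `j_{t₀}^* H²ᵖ(𝒳)` are RANK ONE AT ONE FIBRE `t₀` in each degree `2p ≤ d`, the degree `p = 0` included
# (the rank is then one at every fibre, part XIV-f; in print: monodromy with no invariants beyond the powers of `θ`,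
# e.g. Zariski-dense in `Sp_{2d}`); so (β′_f) is OPEN only on pencils with EXCESS invariants (Weil / RM / product /
# isotrivial type) — where, by parts XV-b/e, it is the lifting problem for those excess classes
# (header wording per REFEREE-AB R-21 F-ab-67; the theorem statements are unchanged)

HONEST FRAMING (page 1, verbatim): **research route, not a corollary; conditional on HC_CM plus one named
minimal statement.** Cell line: research route conditional on HC_CM; not a corollary; Q11.4-sentence-2
already refuted in dim ≥ 3. Nothing in this file proves a case of the Hodge conjecture for an abelian variety
(on a Lefschetz-generic pencil the invariant classes are powers of the polarisation, so the variational content is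
void — which is exactly the point recorded here). `HC_CM` = `Theses.RankFourFaces.CMAbelianHodge` (a BINDER; not
used in this file), item `Theses.RankFourFaces.CMToAbelian` (stmt-16267) OPEN and not closed here. Seat
`pub-hodge-ring2-ab-andre-2`, gen 7 (with parts XV-a…e).

## What is proved (theorems only; no definition, no named fact, no sorry, no `HC_CM`)

* **`fibreClassLefschetzOn_of_rankOne`** — for a compact pencil `f : 𝒳 ⟶ S` of abelian `d`-folds and a point `t₀`
  with `dim_ℂ j_{t₀}^* H²ᵖ(𝒳(ℂ); ℂ) = 1` for every `p` with `2p ≤ d`: `FibreClassLefschetzOn hf` — all `d`,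
  UNCONDITIONAL (part XV-e: each line is `ℂ·K_{t₀}ᵖ`, so (N_p)(t₀); part XIV-g: product cycles `∑ Dᵢ × Aᵢ` and hard
  Lefschetz for the upper half). The cycles are explicit: multiples of `Kᵖ × K^{d-p}`.
* `invariantCyclesHoldFor_of_rankOne` — Abdulali's (1.1) for such pencils (part VIII's engine).
* `fibreClassLefschetzOn_relDim_four_of_rankOne`, `…_five_of_rankOne` — `d = 4, 5`: rank one in degrees 2 and 4 suffices.
* `fibreClassLefschetzOn_relDim_six_of_rankOne` — `d = 6`: rank one in degrees 2, 4, 6 (symplectic-generic sixfold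
  pencils; NOT the Weil habitat, where degree 6 has rank 3 and part XV-e applies instead).

## Reading (RING2-MAP §AbelianAll (ab-andre-2, gen 7))

Together with parts XIV (d ≤ 3 from (N₁)) and XV-b/c/e this locates the open content of the Lefschetz-type `B_min`
of the André axis precisely: (β′_f) fails to be a theorem only on pencils with EXCESS INVARIANTS — some degree
`2 ≤ 2p ≤ d` with `dim j_{t₀}^*H²ᵖ(𝒳) ≥ 2` — and there it is EQUIVALENT (mod `HC_CM` at a CM fibre with Hodge
invariants) to lifting the excess invariant classes of one fibre to algebraic classes of `𝒳`. The CM-anchored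
pencils that André's Lemme 6.3.1 produces for a Weil class are of the excess kind by construction (the Weil class
is an extra invariant), so this is not a way around W₆; it is the statement that nothing else is in the way.

References: Abdulali1994FamiliesAV (Conj. 5.3, (1.1), Thm. 5.5 pp. 1122, 1130); Andre1996Motifs (§6.3 Lemme 6.3.1,
Remarque 2 pp. 31–33); VoisinHodgeI2002 (§6.2.3 Thm. 6.25); VoisinHodgeII2003 (§9.2.4 Prop. 9.20, (10.7)).
-/

noncomputable section

set_option linter.dupNamespace false

namespace Summit.HodgeConjecture.HodgeConjecture.Ring2.AbelianAll

open CategoryTheory AlgebraicGeometry MonoidalCategory CartesianMonoidalCategory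
open Literature.AlgebraicGeometry Literature.AlgebraicGeometry.Motives
open Literature.AlgebraicGeometry.HodgeTheory
open Literature.AlgebraicGeometry.Abdulali1994 (InvariantCyclesHoldFor)

variable {𝒳 S : SchemeOver ℂ}

/-- **(β′_f) for LEFSCHETZ-GENERIC pencils, unconditionally.** If at one fibre `t₀` the invariant part
`j_{t₀}^* H²ᵖ(𝒳(ℂ); ℂ)` is one-dimensional for every `p` with `2p ≤ d`, then `FibreClassLefschetzOn hf`: (N_p)(t₀)
holds in those degrees (part XV-e, the line is `ℂ · K_{t₀}ᵖ`) and part XIV-g assembles the quasi-inverses from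
product cycles. In print the hypothesis is "the monodromy has no invariants in `H^{2p}(𝒳_t)`, `2p ≤ d`, beyond
`ℚθᵖ`" (e.g. Zariski-dense in `Sp_{2d}`). [cite: Abdulali1994FamiliesAV, Conjecture 5.3 (p. 1130)]
[cite: VoisinHodgeI2002, §6.2.3 Thm. 6.25] [cite: VoisinHodgeII2003, §9.2.4 Prop. 9.20 and (10.7)] -/
theorem fibreClassLefschetzOn_of_rankOne {d : ℕ} {f : 𝒳 ⟶ S} (hf : IsCompactAbelianPencil f d)
    (t₀ : ComplexPoints S)
    (h1 : ∀ p, 2 * p ≤ d → Module.finrank ℂ (LinearMap.range (complexBetti.map (fiberι f t₀) (2 * p)).hom) = 1) :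
    FibreClassLefschetzOn hf :=
  fibreClassLefschetzOn_of_algebraicInvariants_half hf t₀ fun p hp ↦
    algebraicInvariantClassesAt_of_finrank_range_eq_one hf t₀ (by omega) (h1 p hp)

/-- Abdulali's invariant-cycles statement (1.1) for Lefschetz-generic compact pencils (part VIII's engine on the
proved node). [cite: Abdulali1994FamiliesAV, (1.1) (p. 1122) and Theorem 5.5 (p. 1130)] -/
theorem invariantCyclesHoldFor_of_rankOne {d : ℕ} {f : 𝒳 ⟶ S} (hf : IsCompactAbelianPencil f d)
    (t₀ : ComplexPoints S)
    (h1 : ∀ p, 2 * p ≤ d → Module.finrank ℂ (LinearMap.range (complexBetti.map (fiberι f t₀) (2 * p)).hom) = 1) :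
    InvariantCyclesHoldFor f d :=
  invariantCyclesHoldFor_of_fibreClassLefschetzOn hf (fibreClassLefschetzOn_of_rankOne hf t₀ h1)

/-- **`d = 4`**: a compact pencil of abelian FOURFOLDS with rank-one invariants in degrees 2 and 4 at one fibre
satisfies (β′_f). [cite: Abdulali1994FamiliesAV, Conjecture 5.3 (p. 1130)] -/
theorem fibreClassLefschetzOn_relDim_four_of_rankOne {f : 𝒳 ⟶ S} (hf : IsCompactAbelianPencil f 4)
    (t₀ : ComplexPoints S)
    (h2 : Module.finrank ℂ (LinearMap.range (complexBetti.map (fiberι f t₀) (2 * 1)).hom) = 1)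
    (h4 : Module.finrank ℂ (LinearMap.range (complexBetti.map (fiberι f t₀) (2 * 2)).hom) = 1) :
    FibreClassLefschetzOn hf :=
  fibreClassLefschetzOn_of_algebraicInvariants_half hf t₀ fun p hp ↦ by
    obtain rfl | rfl | rfl : p = 0 ∨ p = 1 ∨ p = 2 := by omega
    · exact algebraicInvariantClassesAt_zero hf t₀
    · exact algebraicInvariantClassesAt_of_finrank_range_eq_one hf t₀ (by omega) h2
    · exact algebraicInvariantClassesAt_of_finrank_range_eq_one hf t₀ (by omega) h4

/-- **`d = 5`**: a compact pencil of abelian FIVEFOLDS with rank-one invariants in degrees 2 and 4 at one fibre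
satisfies (β′_f). [cite: Abdulali1994FamiliesAV, Conjecture 5.3 (p. 1130)] -/
theorem fibreClassLefschetzOn_relDim_five_of_rankOne {f : 𝒳 ⟶ S} (hf : IsCompactAbelianPencil f 5)
    (t₀ : ComplexPoints S)
    (h2 : Module.finrank ℂ (LinearMap.range (complexBetti.map (fiberι f t₀) (2 * 1)).hom) = 1)
    (h4 : Module.finrank ℂ (LinearMap.range (complexBetti.map (fiberι f t₀) (2 * 2)).hom) = 1) :
    FibreClassLefschetzOn hf :=
  fibreClassLefschetzOn_of_algebraicInvariants_half hf t₀ fun p hp ↦ by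
    obtain rfl | rfl | rfl : p = 0 ∨ p = 1 ∨ p = 2 := by omega
    · exact algebraicInvariantClassesAt_zero hf t₀
    · exact algebraicInvariantClassesAt_of_finrank_range_eq_one hf t₀ (by omega) h2
    · exact algebraicInvariantClassesAt_of_finrank_range_eq_one hf t₀ (by omega) h4

/-- **`d = 6`, symplectic-generic**: a compact pencil of abelian SIXFOLDS with rank-one invariants in degrees 2, 4
AND 6 at one fibre satisfies (β′_f) (not the Weil habitat, where degree 6 has rank 3 — part XV-e).
[cite: Abdulali1994FamiliesAV, Conjecture 5.3 (p. 1130)] [cite: Andre1996Motifs, §6.3 Remarque 2 (p. 33)] -/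
theorem fibreClassLefschetzOn_relDim_six_of_rankOne {f : 𝒳 ⟶ S} (hf : IsCompactAbelianPencil f 6)
    (t₀ : ComplexPoints S)
    (h2 : Module.finrank ℂ (LinearMap.range (complexBetti.map (fiberι f t₀) (2 * 1)).hom) = 1)
    (h4 : Module.finrank ℂ (LinearMap.range (complexBetti.map (fiberι f t₀) (2 * 2)).hom) = 1)
    (h6 : Module.finrank ℂ (LinearMap.range (complexBetti.map (fiberι f t₀) (2 * 3)).hom) = 1) :
    FibreClassLefschetzOn hf :=
  fibreClassLefschetzOn_relDim_six_of_rankOne_of_algebraicInvariantClassesAt_three hf t₀ h2 h4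
    (algebraicInvariantClassesAt_of_finrank_range_eq_one hf t₀ (by omega) h6)

end Summit.HodgeConjecture.HodgeConjecture.Ring2.AbelianAll

end
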